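import Literature.MathematicalPhysics.QuantumLattice.HubbardMultiFermionDecaySharp
import HarnessLib

/-!
# Koma–Tasaki decay in one dimension: exponential clustering on the Hubbard ring, explicit constants

Trunk T-QLATTICE (family `hubbard`; consumer: the cell file
`Summits/HubbardSuperconductivity/HubbardLadder/Bounds/RingExponentialClustering.lean`;
companion: `HubbardMultiFermionDecaySharp.lean` (the two-dimensional power laws)).

Koma–Tasaki, PRL 68 (1992) 3248, Theorem, last clause: "In one dimension, the theorem is valid
with the right-hand sides of (2), (3), and (4) replaced with `2 exp[-γ f(β)|x-y|]`,
`2 exp[-γ f(2β)|x-y|/2]`, and `exp[-γ f(β)|x-y|]`, respectively, where `γ` is a constant", with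
`f(β) ≈ 1/β` at low temperatures (p. 3249). The printed constants `γ`, `β₀` are not specified.
This file proves the one-dimensional clause with EXPLICIT constants (the tree already had
explicit ones for the on-site pair and the spins — see "Relation to what the tree already
proves" below), in the generality of
footnote [10] (every `n`-fermion pairing operator), for the grand-canonical Hubbard model
`H(t,U) - μN` on the ring `ℤ/Lℤ` (`hubbardTorusWith 1 L t U μ`), uniformly in `L`, for all real
`t, U, μ` and all `β ≥ 0`:

* `norm_thermalCorr_fermionProduct_torusD_le_exp_sharp` — the printed a priori gauge bound
  (eqs. (6)–(12), hopping norm `‖c†_u c_v + h.c.‖ = 1`) on `(ℤ/Lℤ)^d`, every `d`, for potentials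
  flat on the supports;
* `ringProfile_energy_le` — the one-dimensional test function `φ(u) = -q · clamp(dist(u,x); 1, R)`
  has total bond energy `Σ_a Σ_b [a∼b](cosh(φ_a-φ_b)-1) ≤ 4R(cosh q - 1)` (two sites per sphere,
  two neighbours per site);
* `norm_thermalCorr_multiFermion_ring_le_exp` — for `P_x = c_{x+δ₁,σ₁} ⋯ c_{x+δ_n,σ_n}` with
  `δ_i ∈ {0, ±1}` and any `P'_y` of the same length: for every `q ≥ 0`,
  `|⟨(P_x)† P'_y⟩_{β,L}| ≤ e^{2nq} exp(-[nq - 4β|t|(cosh q - 1)] dist(x,y))`;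
* `norm_thermalCorr_multiFermion_ring_le_exp_lowT` — for `n ≤ 8β|t|` (i.e. `T ≤ 8|t|/n`) the
  choice `q = n/(8β|t|)` gives inverse correlation length `≥ n²/(16β|t|) = n²T/(16|t|)`:
  `|⟨(P_x)† P'_y⟩_{β,L}| ≤ e^{n²/(4β|t|)} exp(-n² dist(x,y)/(16β|t|))` — Koma–Tasaki's
  `f(β) ≈ 1/β`, explicit;
* `norm_thermalCorr_multiFermion_ring_le_exp_highT` — for `8β|t| ≤ n`, `q = 1` gives
  `|⟨(P_x)† P'_y⟩_{β,L}| ≤ e^{2n} exp(-(n/2) dist(x,y))`.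

Sources: T. Koma, H. Tasaki, PRL 68 (1992) 3248 (= arXiv:cond-mat/9709068), Theorem (last
clause), eqs. (5)–(13), footnote [10]; O. A. McBryan, T. Spencer, Commun. Math. Phys. 53 (1977)
299 (the complex-rotation method).

## Relation to what the tree already proves

The QUALITATIVE one-dimensional clause is already a theorem of the tree for two correlators:
`koma_tasaki_1d_holds` (`HubbardHubbardModelKomaTasakiProofs`; the on-site `s`-wave pair
`onSitePair`, `n = 2`) and the `d = 1` conjunct of `koma_tasaki_magnetic_holds` (`⟨S⁺_x S⁻_y⟩`)
give `|⟨·⟩_{β,L}| ≤ 1 · exp(-dist(x,y)/(16β|t| + 1))` for all `t, U, μ`, `β > 0`, uniformly in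
`L` — prefactor `1`, rate `1/(16β|t|+1)`, from the linear two-arc profile
`exists_testFunction_one` (charge `q = 1/(16β|t|+1) ≤ 1`, energy `≤ 8q²R`) and the operator-norm
a priori bound `norm_thermalCorr_onSitePair_le` (`le_exp_of_forall_testFunction_one`). Relative
to those, this file adds: (i) SCOPE — every `n`-fermion local product (`n = 1`: the one-particle
Green's function; `n = 2`: triplet / nearest-neighbour bond pairs and pair-hopping correlators,
any spins; `n = 4`: quartets), which had no one-dimensional statement in the tree; (ii) RATES —
the free-charge family with the printed hopping norm, whose low-temperature rate `n²/(16β|t|)`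
is, for `n = 2`, `1/(4β|t|) ≥ 4 · 1/(16β|t|+1)` (four times the tree's), at the price of the
prefactor `e^{n²/(4β|t|)} ≤ e^{2n}` instead of `1` (for the on-site pair the new bound is the
smaller one at every distance `≥ 6` and every `T ≤ 4|t|`: exponents
`1/b - r/(4b) ≤ -r/(16b+1) ⟺ 4(16b+1) ≤ r(12b+1)`, `b = β|t| ≥ 1/4`). Nothing here supersedes
`koma_tasaki_1d_holds`; both bounds hold.

## Mathlib / tree search

Tree: `koma_tasaki_1d_holds`, `koma_tasaki_magnetic_holds`, `le_exp_of_forall_testFunction_one`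
(`HubbardHubbardModelKomaTasakiProofs`), `exists_testFunction_one` (`LatticeToriProofs`) — the
prior one-dimensional results, see above; `norm_thermalCorr_fermionProduct_le_exp_sharp`,
`fermionProduct`, `gaugeWeight` (`HubbardMultiFermionDecaySharp`); `torusDist_le_one_of_adj`, `torusDist_comm'`,
`torusDist_triangle'`, `card_filter_torusDist_eq_le`, `card_filter_adj_le`, `cosh_sub_one_le_sq`
(`LatticeToriProofs`);
`torusNorm_proj_le_one` (`HohenbergMerminWagnerPairing`); `FermionTorus.equivTorusSite`,
`hubbardTorusWith` (`HubbardModel`). Mathlib: `Real.cosh_le_cosh`, `Real.one_le_cosh`,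
`Finset.card_eq_sum_card_fiberwise`,
`Finset.sum_ite_mem`.

## Design notes

No statement of the tree is changed. `torusFermionProductD d` / `multiFermionD d` are the
`d`-dimensional copies of the companion's `torusFermionProduct` / `multiFermion` (which are the
case `d = 2`, definitionally: `multiFermionD_two`). The one-dimensional profile is linear (a
clamped cone), not logarithmic: on the ring the spheres have at most two sites, so a linear
profile has bond energy linear in the distance and the gain beats it for small `q` — this is the
mechanism behind the printed `exp[-γ f(β)|x-y|]`.
-/

noncomputable section

namespace Literature.MathematicalPhysics.QuantumLattice

open Matrix Finset NormedSpace Literature.Probability.LatticeModels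
  Literature.Barriers.HubbardSuperconductivity
open scoped Matrix.Norms.L2Operator ComplexOrder

/-! ### The printed a priori bound on `(ℤ/Lℤ)^d`, flat potentials -/

section TorusD

variable {d L : ℕ} [NeZero L]

/-- The gauge weight of a torus orbital list transported to the fermionic torus is `Σ_i φ(x_i)`
(any dimension). [cite: KomaTasakiPRL1992, eq. (8)] -/
theorem gaugeWeight_map_ofTorusSiteD (φ : TorusSite d L → ℝ)
    (l : List (TorusSite d L × Fin 2)) :
    gaugeWeight (fun u => φ (FermionTorus.toTorusSite u))
        (l.map fun p => (FermionTorus.ofTorusSite p.1, p.2)) = (l.map fun p => φ p.1).sum := by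
  simp [gaugeWeight, List.map_map, Function.comp_def, FermionTorus.toTorusSite_ofTorusSite]

/-- A flat potential weighs a list by its length. [folklore] -/
private theorem sum_map_eq_length_mulD {α : Type*} (φ : α → ℝ) (c : ℝ) (l : List (α × Fin 2))
    (h : ∀ p ∈ l, φ p.1 = c) : (l.map fun p => φ p.1).sum = (l.length : ℝ) * c := by
  induction l with
  | nil => simp
  | cons p l ih =>
      rw [List.map_cons, List.sum_cons, List.length_cons, h p (by simp),
        ih (fun q hq => h q (by simp [hq]))]
      push_cast
      ring

variable (d) in
/-- The torus orbital list transported to the fermionic torus `FermionTorus d L` (any `d`).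
[cite: KomaTasakiPRL1992, footnote [10]] -/
def torusFermionProductD (l : List (TorusSite d L × Fin 2)) :
    Matrix (Finset (Orb (FermionTorus d L))) (Finset (Orb (FermionTorus d L))) ℂ :=
  fermionProduct (l.map fun p => (FermionTorus.ofTorusSite p.1, p.2))

/-- **The printed a priori bound on `(ℤ/Lℤ)^d` for flat potentials** (eqs. (6)–(12), footnote
[10]): if `φ` is constant (`= φ x`) on the sites of `l` and (`= φ y`) on the sites of `l'`, then
for `β ≥ 0`
`|⟨(P_l)† P_{l'}⟩_{β,L}| ≤ e^{-|l| φ_x + |l'| φ_y} exp[β|t| Σ_a Σ_b [a∼b](cosh(φ_a-φ_b)-1)]`.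
[cite: KomaTasakiPRL1992, eqs. (6)–(12) and footnote [10]] -/
theorem norm_thermalCorr_fermionProduct_torusD_le_exp_sharp (t U μ : ℝ) {β : ℝ} (hβ : 0 ≤ β)
    (φ : TorusSite d L → ℝ) (x y : TorusSite d L) (l l' : List (TorusSite d L × Fin 2))
    (hx : ∀ p ∈ l, φ p.1 = φ x) (hy : ∀ p ∈ l', φ p.1 = φ y) :
    ‖(hubbardTorusWith d L t U μ).thermalCorr β
        (torusFermionProductD d l)ᴴ (torusFermionProductD d l')‖ ≤
      Real.exp (-((l.length : ℝ) * φ x) + (l'.length : ℝ) * φ y) * Real.exp (β * |t| *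
        ∑ a : TorusSite d L, ∑ b : TorusSite d L,
          (if (torusGraph d L).Adj a b then (Real.cosh (φ a - φ b) - 1) else 0)) := by
  have key := norm_thermalCorr_fermionProduct_le_exp_sharp (fermionTorusGraph d L) t U μ hβ
    (fun u => φ (FermionTorus.toTorusSite u))
    (l.map fun p => (FermionTorus.ofTorusSite p.1, p.2))
    (l'.map fun p => (FermionTorus.ofTorusSite p.1, p.2))
  have hsumeq : (∑ u : FermionTorus d L, ∑ v : FermionTorus d L,
      if (fermionTorusGraph d L).Adj u v then
        (Real.cosh (φ (FermionTorus.toTorusSite u) - φ (FermionTorus.toTorusSite v)) - 1)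
      else 0) =
      ∑ a : TorusSite d L, ∑ b : TorusSite d L,
        if (torusGraph d L).Adj a b then (Real.cosh (φ a - φ b) - 1) else 0 := by
    refine Fintype.sum_equiv FermionTorus.equivTorusSite _ _ fun u => ?_
    refine Fintype.sum_equiv FermionTorus.equivTorusSite _ _ fun v => ?_
    simp [FermionTorus.equivTorusSite]
  rw [hsumeq, gaugeWeight_map_ofTorusSiteD, gaugeWeight_map_ofTorusSiteD,
    sum_map_eq_length_mulD φ (φ x) l hx, sum_map_eq_length_mulD φ (φ y) l' hy] at key
  unfold torusFermionProductD
  refine Eq.trans_le ?_ (key.trans_eq ?_)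
  · congr!
  · ring

variable (d) in
/-- **Koma–Tasaki's general pairing operator on `(ℤ/Lℤ)^d`** (footnote [10]):
`P_x = c_{x+δ₁,σ₁} ⋯ c_{x+δ_n,σ_n}` for fixed lattice vectors `δ_i ∈ ℤ^d` (computed in
`(ℤ/Lℤ)^d`) and spins `σ_i`. [cite: KomaTasakiPRL1992, footnote [10]] -/
def multiFermionD {n : ℕ} (δ : Fin n → Site d) (σ : Fin n → Fin 2) (L : ℕ) [NeZero L]
    (x : TorusSite d L) :
    Matrix (Finset (Orb (FermionTorus d L))) (Finset (Orb (FermionTorus d L))) ℂ :=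
  torusFermionProductD d (List.ofFn fun i => (x + Torus.proj L (δ i), σ i))

/-- In two dimensions `multiFermionD 2` is the companion's `multiFermion` (definitionally).
[cite: KomaTasakiPRL1992, footnote [10]] -/
theorem multiFermionD_two {n : ℕ} (δ : Fin n → Site 2) (σ : Fin n → Fin 2) (L : ℕ) [NeZero L]
    (x : TorusSite 2 L) : multiFermionD 2 δ σ L x = multiFermion δ σ L x := rfl

/-- The support of `P_x` lies in the unit neighbourhood of `x` when all steps have coordinates
in `{0, 1, -1}`: a potential flat there is constant on the support. [folklore] -/
private theorem flat_on_ofFnD {n : ℕ} (δ : Fin n → Site d) (σ : Fin n → Fin 2)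
    (hδ : ∀ i j, δ i j = 0 ∨ δ i j = 1 ∨ δ i j = -1) (φ : TorusSite d L → ℝ) (x : TorusSite d L)
    (hflat : ∀ u, torusDist u x ≤ 1 → φ u = φ x) :
    ∀ p ∈ (List.ofFn fun i => (x + Torus.proj L (δ i), σ i)), φ p.1 = φ x := by
  intro p hp
  rw [List.mem_ofFn] at hp
  obtain ⟨i, rfl⟩ := hp
  refine hflat _ ?_
  show torusNorm (x + Torus.proj L (δ i) - x) ≤ 1
  rw [add_sub_cancel_left]
  exact torusNorm_proj_le_one L (hδ i)

/-- **A priori: `|⟨(P_x)† P'_y⟩_{β,L}| ≤ 1`** on `(ℤ/Lℤ)^d` (`φ = 0`; `‖P‖ ≤ 1`).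
[cite: KomaTasakiPRL1992, eq. (10) and footnote [10]] -/
theorem norm_thermalCorr_multiFermionD_le_one {n : ℕ} (δ δ' : Fin n → Site d)
    (σ σ' : Fin n → Fin 2) (t U μ β : ℝ) (hβ : 0 ≤ β) (x y : TorusSite d L) :
    ‖(hubbardTorusWith d L t U μ).thermalCorr β
        (multiFermionD d δ σ L x)ᴴ (multiFermionD d δ' σ' L y)‖ ≤ 1 := by
  have h := norm_thermalCorr_fermionProduct_torusD_le_exp_sharp (d := d) t U μ hβ (fun _ => 0)
    x y (List.ofFn fun i => (x + Torus.proj L (δ i), σ i))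
    (List.ofFn fun i => (y + Torus.proj L (δ' i), σ' i)) (fun _ _ => rfl) (fun _ _ => rfl)
  simp only [mul_zero, neg_zero, add_zero, Real.exp_zero, one_mul, sub_self, Real.cosh_zero,
    ite_self, Finset.sum_const_zero] at h
  unfold multiFermionD
  exact h

end TorusD

/-! ### The one-dimensional test function: a clamped cone -/

section Ring

variable {L : ℕ} [NeZero L]

/-- The clamped distance `clamp(dist(u,x); 1, R) = min (max dist(u,x) 1) R` on the ring.
[cite: KomaTasakiPRL1992, Theorem (one-dimensional clause)] -/
def ringClamp (x : TorusSite 1 L) (R : ℕ) (u : TorusSite 1 L) : ℕ := min (max (torusDist u x) 1) R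

/-- The one-dimensional Koma–Tasaki / McBryan–Spencer test function: the clamped cone
`φ(u) = -q · clamp(dist(u,x); 1, R)`. [cite: KomaTasakiPRL1992, Theorem (one-dimensional clause)] -/
def ringProfile (x : TorusSite 1 L) (R : ℕ) (q : ℝ) (u : TorusSite 1 L) : ℝ :=
  -(q * (ringClamp x R u : ℝ))

omit [NeZero L] in
/-- Near the centre (`dist(u,x) ≤ 1`, `R ≥ 1`) the clamp is `1`. [folklore] -/
private theorem ringClamp_of_dist_le_one {x u : TorusSite 1 L} {R : ℕ} (hR : 1 ≤ R)
    (hu : torusDist u x ≤ 1) : ringClamp x R u = 1 := by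
  unfold ringClamp
  rw [max_eq_right hu, min_eq_left hR]

omit [NeZero L] in
/-- Far from the centre (`dist(u,x) ≥ R`) the clamp is `R`. [folklore] -/
private theorem ringClamp_of_le_dist {x u : TorusSite 1 L} {R : ℕ} (hu : R ≤ torusDist u x) :
    ringClamp x R u = R := by
  unfold ringClamp
  exact min_eq_right (le_trans hu (le_max_left _ _))

/-- The torus distance to a fixed site is `1`-Lipschitz along ring edges. [folklore] -/
private theorem torusDist_adj_le (x : TorusSite 1 L) {u v : TorusSite 1 L}
    (h : (torusGraph 1 L).Adj u v) :
    torusDist u x ≤ torusDist v x + 1 ∧ torusDist v x ≤ torusDist u x + 1 := by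
  have h1 : torusDist u x ≤ 1 + torusDist v x :=
    (torusDist_triangle' u v x).trans (by have := torusDist_le_one_of_adj h; omega)
  have h2 : torusDist v x ≤ 1 + torusDist u x :=
    (torusDist_triangle' v u x).trans (by
      have := torusDist_le_one_of_adj ((torusGraph 1 L).adj_symm h); omega)
  constructor <;> omega

/-- The clamp is `1`-Lipschitz along ring edges. [folklore] -/
private theorem ringClamp_lipschitz (x : TorusSite 1 L) (R : ℕ) {u v : TorusSite 1 L}
    (h : (torusGraph 1 L).Adj u v) :
    ringClamp x R u ≤ ringClamp x R v + 1 ∧ ringClamp x R v ≤ ringClamp x R u + 1 := by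
  have hd := torusDist_adj_le x h
  unfold ringClamp
  constructor <;> omega

/-- Outside the annulus `1 ≤ dist(u,x) ≤ R` the clamp does not change along an edge at `u`.
[folklore] -/
private theorem ringClamp_eq_of_not_mem_annulus (x : TorusSite 1 L) (R : ℕ) {u v : TorusSite 1 L}
    (h : (torusGraph 1 L).Adj u v) (hu : ¬ (1 ≤ torusDist u x ∧ torusDist u x ≤ R)) :
    ringClamp x R u = ringClamp x R v := by
  have hd := torusDist_adj_le x h
  rw [not_and_or, not_le, not_le] at hu
  unfold ringClamp
  rcases hu with hu | hu <;> omega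

/-- Along an edge the profile changes by at most `q`, so each bond term is `≤ cosh q - 1`.
[cite: KomaTasakiPRL1992, eq. (12)] -/
theorem cosh_ringProfile_sub_le (x : TorusSite 1 L) (R : ℕ) {q : ℝ} (hq : 0 ≤ q)
    {u v : TorusSite 1 L} (h : (torusGraph 1 L).Adj u v) :
    Real.cosh (ringProfile x R q u - ringProfile x R q v) - 1 ≤ Real.cosh q - 1 := by
  have hlip := ringClamp_lipschitz x R h
  have h1 : (ringClamp x R u : ℝ) ≤ ringClamp x R v + 1 := by exact_mod_cast hlip.1
  have h2 : (ringClamp x R v : ℝ) ≤ ringClamp x R u + 1 := by exact_mod_cast hlip.2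
  have hdiff : |ringProfile x R q u - ringProfile x R q v| ≤ |q| := by
    rw [abs_of_nonneg hq]
    unfold ringProfile
    rw [show -(q * (ringClamp x R u : ℝ)) - -(q * (ringClamp x R v : ℝ)) =
        q * ((ringClamp x R v : ℝ) - ringClamp x R u) by ring, abs_mul, abs_of_nonneg hq]
    refine mul_le_of_le_one_right hq ?_
    rw [abs_sub_le_iff]
    constructor <;> linarith
  have := Real.cosh_le_cosh.2 hdiff
  linarith

/-- **Energy of the clamped cone on the ring**: `Σ_a Σ_b [a∼b](cosh(φ_a-φ_b)-1) ≤ 4R(cosh q-1)`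
— only sites in the annulus `1 ≤ dist(a,x) ≤ R` contribute (at most `2R` of them, two per
sphere), each with at most two neighbours and bond terms `≤ cosh q - 1`.
[cite: KomaTasakiPRL1992, Theorem (one-dimensional clause), eq. (12)] -/
theorem ringProfile_energy_le (x : TorusSite 1 L) (R : ℕ) {q : ℝ} (hq : 0 ≤ q) :
    ∑ a : TorusSite 1 L, ∑ b : TorusSite 1 L,
        (if (torusGraph 1 L).Adj a b then
          (Real.cosh (ringProfile x R q a - ringProfile x R q b) - 1) else 0) ≤
      4 * R * (Real.cosh q - 1) := by
  classical
  set A : Finset (TorusSite 1 L) :=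
    univ.filter fun u => 1 ≤ torusDist u x ∧ torusDist u x ≤ R with hA
  have hC : 0 ≤ Real.cosh q - 1 := sub_nonneg.2 (Real.one_le_cosh q)
  have hinner : ∀ a : TorusSite 1 L, (∑ b : TorusSite 1 L,
      (if (torusGraph 1 L).Adj a b then
        (Real.cosh (ringProfile x R q a - ringProfile x R q b) - 1) else 0)) ≤
      if a ∈ A then 2 * (Real.cosh q - 1) else 0 := by
    intro a
    split_ifs with ha
    · rw [← Finset.sum_filter]
      calc ∑ b ∈ univ.filter (fun b => (torusGraph 1 L).Adj a b),
            (Real.cosh (ringProfile x R q a - ringProfile x R q b) - 1)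
          ≤ ∑ b ∈ univ.filter (fun b => (torusGraph 1 L).Adj a b), (Real.cosh q - 1) :=
            Finset.sum_le_sum fun b hb => cosh_ringProfile_sub_le x R hq
              (by simpa using hb)
        _ = ((univ.filter fun b => (torusGraph 1 L).Adj a b).card : ℝ) * (Real.cosh q - 1) := by
            rw [Finset.sum_const, nsmul_eq_mul]
        _ ≤ 2 * (Real.cosh q - 1) := by
            gcongr
            exact_mod_cast (card_filter_adj_le a).trans (by norm_num)
    · refine (Finset.sum_eq_zero fun b _ => ?_).le
      split_ifs with hab
      · have hab' : ringClamp x R a = ringClamp x R b :=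
          ringClamp_eq_of_not_mem_annulus x R hab (by simpa [hA] using ha)
        simp [ringProfile, hab']
      · rfl
  have hcardA : A.card ≤ 2 * R := by
    have hmaps : ∀ u ∈ A, torusDist u x ∈ Finset.Icc 1 R := by
      intro u hu
      simpa [hA, Finset.mem_Icc] using hu
    rw [Finset.card_eq_sum_card_fiberwise hmaps]
    calc ∑ k ∈ Icc 1 R, (A.filter fun u => torusDist u x = k).card
        ≤ ∑ k ∈ Icc 1 R, 2 := Finset.sum_le_sum fun k _ => by
          calc (A.filter fun u => torusDist u x = k).card
              ≤ (univ.filter fun u : TorusSite 1 L => torusDist u x = k).card :=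
                card_le_card (Finset.filter_subset_filter _ (Finset.subset_univ A))
            _ ≤ 1 * (2 * (2 * k + 1) ^ (1 - 1)) := card_filter_torusDist_eq_le one_pos x k
            _ = 2 := by norm_num
      _ = 2 * R := by simp [Nat.card_Icc, mul_comm]
  calc ∑ a : TorusSite 1 L, ∑ b : TorusSite 1 L,
        (if (torusGraph 1 L).Adj a b then
          (Real.cosh (ringProfile x R q a - ringProfile x R q b) - 1) else 0)
      ≤ ∑ a : TorusSite 1 L, (if a ∈ A then 2 * (Real.cosh q - 1) else 0) :=
        Finset.sum_le_sum fun a _ => hinner a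
    _ = (A.card : ℝ) * (2 * (Real.cosh q - 1)) := by
        rw [Finset.sum_ite_mem, Finset.univ_inter, Finset.sum_const, nsmul_eq_mul]
    _ ≤ ((2 * R : ℕ) : ℝ) * (2 * (Real.cosh q - 1)) := by
        gcongr
    _ = 4 * R * (Real.cosh q - 1) := by push_cast; ring

/-! ### Exponential clustering of every `n`-fermion correlation on the Hubbard ring -/

/-- **Sharp one-dimensional Koma–Tasaki bound, every `n`-fermion pairing operator** (Theorem,
one-dimensional clause, in the generality of footnote [10]; printed hopping norm): on the
Hubbard ring `ℤ/Lℤ` with Hamiltonian `H(t,U) - μN`, for all real `t, U, μ`, `β ≥ 0`, every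
`q ≥ 0`, steps `δ_i, δ'_i ∈ {0, ±1}`, arbitrary spins and all sites `x, y`:
`|⟨(P_x)† P'_y⟩_{β,L}| ≤ e^{2nq} exp(-[nq - 4β|t|(cosh q - 1)] dist(x,y))`, uniformly in `L`.
[cite: KomaTasakiPRL1992, Theorem (one-dimensional clause), eqs. (5)–(13), footnote [10]] [cite: McBryanSpencer1977] -/
theorem norm_thermalCorr_multiFermion_ring_le_exp (L : ℕ) [NeZero L] {n : ℕ}
    (δ δ' : Fin n → Site 1) (σ σ' : Fin n → Fin 2)
    (hδ : ∀ i j, δ i j = 0 ∨ δ i j = 1 ∨ δ i j = -1)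
    (hδ' : ∀ i j, δ' i j = 0 ∨ δ' i j = 1 ∨ δ' i j = -1)
    (t U μ β q : ℝ) (hβ : 0 ≤ β) (hq : 0 ≤ q) (x y : TorusSite 1 L) :
    ‖(hubbardTorusWith 1 L t U μ).thermalCorr β
        (multiFermionD 1 δ σ L x)ᴴ (multiFermionD 1 δ' σ' L y)‖ ≤
      Real.exp (2 * n * q) *
        Real.exp (-((n * q - 4 * (β * |t|) * (Real.cosh q - 1)) * (torusDist x y : ℝ))) := by
  have hC : 0 ≤ Real.cosh q - 1 := sub_nonneg.2 (Real.one_le_cosh q)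
  have hb : 0 ≤ β * |t| := mul_nonneg hβ (abs_nonneg t)
  rw [← Real.exp_add]
  rcases le_or_gt (torusDist x y) 1 with hr1 | hr2
  · -- short distances: the correlation is at most `1`
    refine (norm_thermalCorr_multiFermionD_le_one δ δ' σ σ' t U μ β hβ x y).trans
      (Real.one_le_exp ?_)
    have hr1' : (torusDist x y : ℝ) ≤ 1 := by exact_mod_cast hr1
    have hr0 : (0 : ℝ) ≤ torusDist x y := Nat.cast_nonneg _
    have hnq : 0 ≤ (n : ℝ) * q := mul_nonneg (Nat.cast_nonneg _) hq
    nlinarith [mul_nonneg (mul_nonneg hb hC) hr0, mul_nonneg hnq (sub_nonneg.2 hr1')]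
  · -- `r ≥ 2`: the clamped cone with `R = r - 1`
    set r : ℕ := torusDist x y with hr
    have hR1 : 1 ≤ r - 1 := by omega
    set φ : TorusSite 1 L → ℝ := ringProfile x (r - 1) q with hφ
    have hflx : ∀ u, torusDist u x ≤ 1 → φ u = φ x := by
      intro u hu
      simp only [hφ, ringProfile, ringClamp_of_dist_le_one hR1 hu,
        ringClamp_of_dist_le_one hR1 (show torusDist x x ≤ 1 by simp)]
    have hfar : ∀ u, torusDist u y ≤ 1 → r - 1 ≤ torusDist u x := by
      intro u hu
      have htri : torusDist x y ≤ torusDist x u + torusDist u y := torusDist_triangle' x u y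
      rw [torusDist_comm' x u] at htri
      omega
    have hfly : ∀ u, torusDist u y ≤ 1 → φ u = φ y := by
      intro u hu
      have hy0 : r - 1 ≤ torusDist y x := hfar y (by simp)
      simp only [hφ, ringProfile, ringClamp_of_le_dist (hfar u hu), ringClamp_of_le_dist hy0]
    have key := norm_thermalCorr_fermionProduct_torusD_le_exp_sharp (d := 1) t U μ hβ φ x y
      (List.ofFn fun i => (x + Torus.proj L (δ i), σ i))
      (List.ofFn fun i => (y + Torus.proj L (δ' i), σ' i))
      (flat_on_ofFnD δ σ hδ φ x hflx) (flat_on_ofFnD δ' σ' hδ' φ y hfly)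
    rw [List.length_ofFn, List.length_ofFn, ← Real.exp_add] at key
    have hφx : φ x = -q := by
      simp only [hφ, ringProfile, ringClamp_of_dist_le_one hR1 (show torusDist x x ≤ 1 by simp),
        Nat.cast_one, mul_one]
    have hφy : φ y = -(q * ((r - 1 : ℕ) : ℝ)) := by
      simp only [hφ, ringProfile, ringClamp_of_le_dist (hfar y (by simp))]
    have hE := ringProfile_energy_le x (r - 1) hq
    have hE' : β * |t| * ∑ a : TorusSite 1 L, ∑ b : TorusSite 1 L,
        (if (torusGraph 1 L).Adj a b then (Real.cosh (φ a - φ b) - 1) else 0) ≤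
        β * |t| * (4 * ((r - 1 : ℕ) : ℝ) * (Real.cosh q - 1)) :=
      mul_le_mul_of_nonneg_left hE hb
    have hcast : ((r - 1 : ℕ) : ℝ) = (r : ℝ) - 1 := by
      rw [Nat.cast_sub (by omega : 1 ≤ r), Nat.cast_one]
    unfold multiFermionD
    refine key.trans (Real.exp_le_exp.2 ?_)
    rw [hφx, hφy, hcast]
    rw [hcast] at hE'
    have hnq : 0 ≤ (n : ℝ) * q := mul_nonneg (Nat.cast_nonneg _) hq
    nlinarith [mul_nonneg hb hC]

/-- **Low temperatures: inverse correlation length `≥ n²T/(16|t|)`** (the printed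
`f(β) ≈ 1/β`, explicit): if `n ≤ 8β|t|` then, with `q = n/(8β|t|)`,
`|⟨(P_x)† P'_y⟩_{β,L}| ≤ e^{n²/(4β|t|)} exp(-n² dist(x,y)/(16β|t|))`, uniformly in `L`, for
all real `U`, `μ`. [cite: KomaTasakiPRL1992, Theorem (one-dimensional clause) and p. 3249] -/
theorem norm_thermalCorr_multiFermion_ring_le_exp_lowT (L : ℕ) [NeZero L] {n : ℕ}
    (δ δ' : Fin n → Site 1) (σ σ' : Fin n → Fin 2)
    (hδ : ∀ i j, δ i j = 0 ∨ δ i j = 1 ∨ δ i j = -1)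
    (hδ' : ∀ i j, δ' i j = 0 ∨ δ' i j = 1 ∨ δ' i j = -1)
    (t U μ β : ℝ) (hβ : 0 ≤ β) (hn : (n : ℝ) ≤ 8 * (β * |t|)) (x y : TorusSite 1 L) :
    ‖(hubbardTorusWith 1 L t U μ).thermalCorr β
        (multiFermionD 1 δ σ L x)ᴴ (multiFermionD 1 δ' σ' L y)‖ ≤
      Real.exp ((n : ℝ) ^ 2 / (4 * (β * |t|))) *
        Real.exp (-((n : ℝ) ^ 2 / (16 * (β * |t|)) * (torusDist x y : ℝ))) := by
  rcases Nat.eq_zero_or_pos n with hn0 | hnpos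
  · subst hn0
    have h := norm_thermalCorr_multiFermion_ring_le_exp L δ δ' σ σ' hδ hδ' t U μ β 0 hβ le_rfl x y
    simpa using h
  set b : ℝ := β * |t| with hb
  have hbpos : 0 < b := by
    have : (0 : ℝ) < n := by exact_mod_cast hnpos
    nlinarith
  set q : ℝ := n / (8 * b) with hq
  have hq0 : 0 ≤ q := by positivity
  have hq1 : q ≤ 1 := by
    rw [hq, div_le_one (by positivity)]
    exact hn
  have h := norm_thermalCorr_multiFermion_ring_le_exp L δ δ' σ σ' hδ hδ' t U μ β q hβ hq0 x y
  have hcosh : Real.cosh q - 1 ≤ q ^ 2 :=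
    cosh_sub_one_le_sq (s := q) (by rw [abs_of_nonneg hq0]; exact hq1)
  have h2nq : 2 * (n : ℝ) * q = (n : ℝ) ^ 2 / (4 * b) := by
    rw [hq]; field_simp; ring
  have hm : (n : ℝ) ^ 2 / (16 * b) ≤ n * q - 4 * b * (Real.cosh q - 1) := by
    have h4b : 4 * b * (Real.cosh q - 1) ≤ 4 * b * q ^ 2 :=
      mul_le_mul_of_nonneg_left hcosh (by positivity)
    have hval : (n : ℝ) * q - 4 * b * q ^ 2 = (n : ℝ) ^ 2 / (16 * b) := by
      rw [hq]; field_simp; ring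
    linarith
  refine h.trans ?_
  rw [h2nq]
  refine mul_le_mul_of_nonneg_left (Real.exp_le_exp.2 ?_) (Real.exp_pos _).le
  have hr0 : (0 : ℝ) ≤ torusDist x y := Nat.cast_nonneg _
  nlinarith

/-- **High temperatures** (`8β|t| ≤ n`): with `q = 1` and `cosh 1 - 1 ≤ 1`,
`|⟨(P_x)† P'_y⟩_{β,L}| ≤ e^{2n} exp(-(n/2) dist(x,y))`, uniformly in `L`, all real `U`, `μ`.
[cite: KomaTasakiPRL1992, Theorem (one-dimensional clause) and p. 3249] -/
theorem norm_thermalCorr_multiFermion_ring_le_exp_highT (L : ℕ) [NeZero L] {n : ℕ}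
    (δ δ' : Fin n → Site 1) (σ σ' : Fin n → Fin 2)
    (hδ : ∀ i j, δ i j = 0 ∨ δ i j = 1 ∨ δ i j = -1)
    (hδ' : ∀ i j, δ' i j = 0 ∨ δ' i j = 1 ∨ δ' i j = -1)
    (t U μ β : ℝ) (hβ : 0 ≤ β) (hn : 8 * (β * |t|) ≤ n) (x y : TorusSite 1 L) :
    ‖(hubbardTorusWith 1 L t U μ).thermalCorr β
        (multiFermionD 1 δ σ L x)ᴴ (multiFermionD 1 δ' σ' L y)‖ ≤
      Real.exp (2 * n) * Real.exp (-((n : ℝ) / 2 * (torusDist x y : ℝ))) := by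
  have h := norm_thermalCorr_multiFermion_ring_le_exp L δ δ' σ σ' hδ hδ' t U μ β 1 hβ
    zero_le_one x y
  have hcosh : Real.cosh 1 - 1 ≤ 1 := by
    have := cosh_sub_one_le_sq (s := (1 : ℝ)) (by norm_num)
    simpa using this
  have hb : 0 ≤ β * |t| := mul_nonneg hβ (abs_nonneg t)
  rw [mul_one] at h
  refine h.trans (mul_le_mul_of_nonneg_left (Real.exp_le_exp.2 ?_) (Real.exp_pos _).le)
  have hr0 : (0 : ℝ) ≤ torusDist x y := Nat.cast_nonneg _
  have hm : (n : ℝ) / 2 ≤ n * 1 - 4 * (β * |t|) * (Real.cosh 1 - 1) := by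
    nlinarith [mul_le_mul_of_nonneg_left hcosh (by positivity : (0 : ℝ) ≤ 4 * (β * |t|))]
  nlinarith

end Ring

end Literature.MathematicalPhysics.QuantumLattice
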